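import Literature.NumberTheory.EllipticCurves.IwasawaAlgebraCharacterEvaluation
import Literature.NumberTheory.EllipticCurves.CongrModOmegaOfValuesProofs
import HarnessLib

/-!
# The λ-transport door — THE INTERPOLATION BRIDGE, part A (any prime `p`): analytic evaluation of `g ∈ Λ = ℤ_p⟦T⟧`
# at `T = ζ − 1` (`ζ ∈ μ_{p^∞} ⊂ ℂ_p`) IS the algebraic character value `charEval`, and
# **`Φ_{p^{n+1}}(1+T) ∣ g ⟺ g(ζ − 1) = 0` for ONE (equivalently every) primitive `p^{n+1}`-th root of unity `ζ`**

Cell `bsd-rank2`, seat p2, GEN 67 part A (helper toward `EisensteinDepletionAtTwo.DepletedLambdaLawAtTwoModNSF`,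
stmt-BirchSwinnertonDyer-27021; consumed by parts B/C, which turn the GEN 66 `Λ`-divisibility laws on the Matsuno class
`𝒞(15A8)` — `ν_k ∤ L₂(A,T)` (`k ≥ 3`), the `ν₂`-criterion, `L₂ = 2^μ T² · unit` on rank-two members — into statements about
the CLASSICAL twisted values `L(A, χ, 1)`).  HONEST FRAMING: pure commutative algebra / `p`-adic analysis of `Λ`; theorems
only (no definition, no named fact, no instance, no `sorry`); nothing about any curve is asserted and BSD is proved for no curve.

Two evaluations of `g ∈ Λ` at a `p`-power root of unity `ζ ∈ ℂ_p` live in the tree and were not yet identified: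
* the ANALYTIC one, `g(ζ − 1) = ∑_k ι(g_k)(ζ − 1)^k` (convergent since `‖ζ − 1‖ < 1`; `PAdicPowerSeriesZeros`:
  `summable_map_coeff_mul_pow`, multiplicativity `tsum_map_coeff_mul_mul_pow`) — this is the currency of the
  Mazur–Tate–Teitelbaum interpolation property `IsPAdicLFunctionOf` / `hasSum_coeff_padicLFunction_unitRoot`
  (`L_p(E, χ(γ) − 1) = α^{−m} ∑_a χ(a)[a/p^m]⁺`), and
* the ALGEBRAIC one, `charEval p ι ζ N g = ∑_{x mod p^N} ι(amice_N(g)(x)) ζ^x` (the image of `g` in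
  `Λ/ω_N ≅ ℤ_p[ℤ/p^N]` paired with the character `1 + T ↦ ζ`; `IwasawaAlgebraCharacterEvaluation`), whose KERNEL at a
  primitive `ζ` is `Φ_{p^{n+1}}(1+T)·Λ` (`coe_cyclotomic_comp_dvd_of_charEval_eq_zero`).

* §1 `hasSum_coeff_mul_pow_charEval` — **they agree**: `HasSum (k ↦ ι(g_k)(ζ−1)^k) (charEval p ι ζ N g)` whenever
  `ζ^{p^N} = 1` (Weierstrass division `g = ω_N q + (Amice polynomial)`, `ω_N(ζ − 1) = 0`; tree
  `tsum_coeff_eq_eval₂_of_omega_dvd_sub`).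
* §2 `charEval_eq_zero_iff_cyclotomic_comp_dvd`, `cyclotomic_comp_dvd_iff_hasSum_zero` — **for a PRIMITIVE `p^{n+1}`-th
  root `ζ`: `Φ_{p^{n+1}}(1+T) ∣ g` in `Λ` ⟺ `charEval_ζ(g) = 0` ⟺ `g(ζ − 1) = 0`** (⟸ is the tree's kernel lemma; ⟹ is
  multiplicativity of evaluation and `Φ_{p^{n+1}}(ζ) = 0`); `cyclotomic_comp_dvd_iff_forall_hasSum_zero` — one primitive
  root ⟺ all of them; `cyclotomic_comp_dvd_iff_hasSum_ratSeries_zero` — the same for `L ∈ ℚ_p⟦T⟧` with `ι(g) = c·L`,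
  `c ≠ 0` (the shape `2^n · L_p(E,T) = ι(G)` of the integral lifts of `p`-adic `L`-functions).

References: [cite: Washington1997, §7.1 Prop. 7.2, §7.2, §12.2 (p. 238)] [cite: MazurTateTeitelbaum1986Invent, §I.12–I.14]
[cite: Lang1990, Ch. 5 §2 Thm. 2.2].
-/

set_option linter.dupNamespace false
set_option autoImplicit false

noncomputable section

open Polynomial Literature.NumberTheory.EllipticCurves Literature.NumberTheory.EllipticCurves.IwasawaAlgebra

namespace Summit.BirchSwinnertonDyer.BirchSwinnertonDyer.Theorems.LambdaTransportDoorCharEvalBridge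

variable {p : ℕ} [hp : Fact p.Prime]

/-! ## §1 Analytic evaluation at `ζ − 1` equals `charEval` -/

/-- The two tree spellings of `ω_N` agree: `toIwasawa p (cyclotomicOmega p N) = (1+T)^{p^N} − 1` in `Λ`. [folklore] -/
theorem toIwasawa_cyclotomicOmega_eq (N : ℕ) :
    Sprung2017.toIwasawa p (cyclotomicOmega p N) = (1 + PowerSeries.X : IwasawaAlgebra p) ^ p ^ N - 1 := by
  have h : Sprung2017.toIwasawa p (cyclotomicOmega p N) = (((X + 1) ^ p ^ N - 1 : ℤ_[p][X]) : PowerSeries ℤ_[p]) := by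
    rw [Sprung2017.toIwasawa, cyclotomicOmega, RingHom.comp_apply, Polynomial.coe_mapRingHom]
    simp only [Polynomial.map_sub, Polynomial.map_pow, Polynomial.map_add, Polynomial.map_X, Polynomial.map_one]
    rfl
  rw [h, Polynomial.coe_sub, Polynomial.coe_pow, Polynomial.coe_add, Polynomial.coe_X, Polynomial.coe_one, add_comm]

/-- ★ **Analytic evaluation at `ζ − 1` IS the algebraic character value.** For `g ∈ Λ = ℤ_p⟦T⟧` and `ζ ∈ ℂ_p` with
`ζ^{p^N} = 1`: `∑_k ι(g_k)(ζ − 1)^k` converges to `charEval p ι ζ N g = ∑_{x mod p^N} ι(amice_N(g)(x)) ζ^x`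
(`ι : ℤ_p → ℚ_p → ℂ_p`).  Proof: `ω_N ∣ g − P(T)` with `P` the (shifted) Amice polynomial (`omega_dvd_sub_amice`), evaluation
only sees `Λ` modulo `ω_N` at such points (`tsum_coeff_eq_eval₂_of_omega_dvd_sub`), and `P(ζ − 1) = charEval`
(`eval_map_sum_monomial_comp`). [cite: Washington1997, §7.1 Prop. 7.2 and §12.2 (p. 238)] -/
theorem hasSum_coeff_mul_pow_charEval (N : ℕ) (g : IwasawaAlgebra p) {ζ : ℂ_[p]} (hζ : ζ ^ p ^ N = 1) :
    HasSum (fun k ↦ ((algebraMap ℚ_[p] ℂ_[p]).comp (algebraMap ℤ_[p] ℚ_[p])) (PowerSeries.coeff k g) * (ζ - 1) ^ k)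
      (charEval p ((algebraMap ℚ_[p] ℂ_[p]).comp (algebraMap ℤ_[p] ℚ_[p])) ζ N g) := by
  classical
  set ιZ : ℤ_[p] →+* ℂ_[p] := (algebraMap ℚ_[p] ℂ_[p]).comp (algebraMap ℤ_[p] ℚ_[p]) with hιZ
  have hdvd : Sprung2017.toIwasawa p (cyclotomicOmega p N) ∣ g -
      ((((∑ x : ZMod (p ^ N), monomial x.val (amice p N g x)).comp (X + 1) : ℤ_[p][X])) : PowerSeries ℤ_[p]) := by
    rw [toIwasawa_cyclotomicOmega_eq, coe_sum_monomial_comp]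
    exact omega_dvd_sub_amice p N g
  have hz : (1 + (ζ - 1)) ^ p ^ N = 1 := by rwa [add_sub_cancel]
  have htsum := tsum_coeff_eq_eval₂_of_omega_dvd_sub hdvd hz
  have hev : ((∑ x : ZMod (p ^ N), monomial x.val (amice p N g x)).comp (X + 1)).eval₂ ιZ (ζ - 1) =
      charEval p ιZ ζ N g := by
    rw [← Polynomial.eval_map, eval_map_sum_monomial_comp, charEval_def]
  have hs : Summable fun k ↦ ιZ (PowerSeries.coeff k g) * (ζ - 1) ^ k :=
    summable_map_coeff_mul_pow ιZ (norm_algebraMap_coeff_le_one g) (norm_sub_one_lt_one_of_pow_prime_pow_eq_one hζ)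
  rw [← hev, ← htsum]
  exact hs.hasSum

/-- The analytic value as a `tsum`: `∑' k, ι(g_k)(ζ − 1)^k = charEval p ι ζ N g` for `ζ^{p^N} = 1`.
[cite: Washington1997, §12.2 (p. 238)] -/
theorem tsum_coeff_mul_pow_eq_charEval (N : ℕ) (g : IwasawaAlgebra p) {ζ : ℂ_[p]} (hζ : ζ ^ p ^ N = 1) :
    ∑' k, ((algebraMap ℚ_[p] ℂ_[p]).comp (algebraMap ℤ_[p] ℚ_[p])) (PowerSeries.coeff k g) * (ζ - 1) ^ k =
      charEval p ((algebraMap ℚ_[p] ℂ_[p]).comp (algebraMap ℤ_[p] ℚ_[p])) ζ N g :=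
  (hasSum_coeff_mul_pow_charEval N g hζ).tsum_eq

/-! ## §2 `Φ_{p^{n+1}}(1+T) ∣ g ⟺ g(ζ − 1) = 0` at a primitive `p^{n+1}`-th root of unity -/

/-- `Φ_{p^{n+1}}(1+T)`, read in `ℂ_p`, vanishes at `T = ζ − 1` for a primitive `p^{n+1}`-th root of unity `ζ`. [folklore] -/
theorem eval₂_cyclotomic_comp_eq_zero (n : ℕ) {ζ : ℂ_[p]} (hζ : IsPrimitiveRoot ζ (p ^ (n + 1))) :
    (((cyclotomic (p ^ (n + 1)) ℤ).comp (X + 1)).map (Int.castRingHom ℤ_[p])).eval₂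
      ((algebraMap ℚ_[p] ℂ_[p]).comp (algebraMap ℤ_[p] ℚ_[p])) (ζ - 1) = 0 := by
  rw [← Polynomial.eval_map, Polynomial.map_map, Polynomial.map_comp, Polynomial.eval_comp, Polynomial.map_add,
    Polynomial.map_X, Polynomial.map_one, Polynomial.eval_add, Polynomial.eval_X, Polynomial.eval_one, sub_add_cancel,
    Polynomial.map_cyclotomic]
  exact (hζ.isRoot_cyclotomic (pow_pos hp.out.pos _)).eq_zero

/-- ★★ **KERNEL CRITERION.** For `g ∈ Λ` and a PRIMITIVE `p^{n+1}`-th root of unity `ζ ∈ ℂ_p`: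
`charEval p ι ζ (n+1) g = 0 ⟺ Φ_{p^{n+1}}(1+T) ∣ g` in `Λ`.  (⟹: the tree's `coe_cyclotomic_comp_dvd_of_charEval_eq_zero`
— the Amice polynomial vanishes at `ζ`, `Φ` is irreducible over `ℚ_p`, and `Φ(1+T) ∣ ω_{n+1}`; ⟸: `g = Φ(1+T)·q`, evaluation at
`ζ − 1` is multiplicative on `Λ` and `Φ(ζ) = 0`, and the analytic value is `charEval` by §1.)
[cite: Washington1997, §7.1 Prop. 7.2, §7.2] [cite: MazurTateTeitelbaum1986Invent, §I.12] -/
theorem charEval_eq_zero_iff_cyclotomic_comp_dvd (n : ℕ) (g : IwasawaAlgebra p) {ζ : ℂ_[p]}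
    (hζ : IsPrimitiveRoot ζ (p ^ (n + 1))) :
    charEval p ((algebraMap ℚ_[p] ℂ_[p]).comp (algebraMap ℤ_[p] ℚ_[p])) ζ (n + 1) g = 0 ↔
      ((((cyclotomic (p ^ (n + 1)) ℤ).comp (X + 1)).map (Int.castRingHom ℤ_[p]) : ℤ_[p][X]) : IwasawaAlgebra p) ∣ g := by
  set ιZ : ℤ_[p] →+* ℂ_[p] := (algebraMap ℚ_[p] ℂ_[p]).comp (algebraMap ℤ_[p] ℚ_[p]) with hιZ
  refine ⟨coe_cyclotomic_comp_dvd_of_charEval_eq_zero p n (algebraMap ℚ_[p] ℂ_[p]) hζ, ?_⟩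
  rintro ⟨q, hq⟩
  have hζ1 : ζ ^ p ^ (n + 1) = 1 := hζ.pow_eq_one
  have hz : ‖ζ - 1‖ < 1 := norm_sub_one_lt_one_of_pow_prime_pow_eq_one hζ1
  have htsum : ∑' k, ιZ (PowerSeries.coeff k g) * (ζ - 1) ^ k = 0 := by
    rw [hq, tsum_map_coeff_mul_mul_pow ιZ (norm_algebraMap_coeff_le_one _) (norm_algebraMap_coeff_le_one _) hz,
      (hasSum_map_coeff_coe_mul_pow ιZ _ (ζ - 1)).tsum_eq, eval₂_cyclotomic_comp_eq_zero n hζ, zero_mul]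
  rw [← tsum_coeff_mul_pow_eq_charEval (n + 1) g hζ1, htsum]

/-- ★★ **`Φ_{p^{n+1}}(1+T) ∣ g ⟺ g(ζ − 1) = 0`** (analytic form): for a primitive `p^{n+1}`-th root of unity `ζ ∈ ℂ_p`,
`Φ_{p^{n+1}}(1+T) ∣ g` in `Λ` iff `HasSum (k ↦ ι(g_k)(ζ − 1)^k) 0`. [cite: Washington1997, §7.2] [cite: MazurTateTeitelbaum1986Invent, §I.12–I.13] -/
theorem cyclotomic_comp_dvd_iff_hasSum_zero (n : ℕ) (g : IwasawaAlgebra p) {ζ : ℂ_[p]}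
    (hζ : IsPrimitiveRoot ζ (p ^ (n + 1))) :
    ((((cyclotomic (p ^ (n + 1)) ℤ).comp (X + 1)).map (Int.castRingHom ℤ_[p]) : ℤ_[p][X]) : IwasawaAlgebra p) ∣ g ↔
      HasSum (fun k ↦ ((algebraMap ℚ_[p] ℂ_[p]).comp (algebraMap ℤ_[p] ℚ_[p])) (PowerSeries.coeff k g) * (ζ - 1) ^ k) 0 := by
  rw [← charEval_eq_zero_iff_cyclotomic_comp_dvd n g hζ]
  have hsum := hasSum_coeff_mul_pow_charEval (n + 1) g hζ.pow_eq_one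
  refine ⟨fun h ↦ ?_, fun h0 ↦ hsum.unique h0⟩
  rwa [h] at hsum

/-- **One primitive root ⟺ every primitive root**: `g(ζ − 1) = 0` for SOME primitive `p^{n+1}`-th root of unity `ζ` iff for
ALL of them (both say `Φ_{p^{n+1}}(1+T) ∣ g`: the Galois conjugates `ζ^a`, `p ∤ a`, are zeros together).
[cite: Washington1997, §7.2] -/
theorem cyclotomic_comp_dvd_iff_forall_hasSum_zero (n : ℕ) (g : IwasawaAlgebra p) :
    ((((cyclotomic (p ^ (n + 1)) ℤ).comp (X + 1)).map (Int.castRingHom ℤ_[p]) : ℤ_[p][X]) : IwasawaAlgebra p) ∣ g ↔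
      ∀ ζ : ℂ_[p], IsPrimitiveRoot ζ (p ^ (n + 1)) →
        HasSum (fun k ↦ ((algebraMap ℚ_[p] ℂ_[p]).comp (algebraMap ℤ_[p] ℚ_[p])) (PowerSeries.coeff k g) * (ζ - 1) ^ k) 0 := by
  haveI : NeZero (p ^ (n + 1)) := ⟨pow_ne_zero _ hp.out.ne_zero⟩
  obtain ⟨ζ₀, hζ₀⟩ := HasEnoughRootsOfUnity.prim (M := ℂ_[p]) (n := p ^ (n + 1))
  exact ⟨fun h ζ hζ ↦ (cyclotomic_comp_dvd_iff_hasSum_zero n g hζ).mp h,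
    fun h ↦ (cyclotomic_comp_dvd_iff_hasSum_zero n g hζ₀).mpr (h ζ₀ hζ₀)⟩

/-- ★★ **Rational form** (the currency of `p`-adic `L`-functions `L ∈ Λ ⊗ ℚ_p`): if `ι(g) = c · L` in `ℚ_p⟦T⟧` with
`c ≠ 0` (e.g. `c = p^m`, an integral lift of `L`), then for a primitive `p^{n+1}`-th root of unity `ζ ∈ ℂ_p`:
`Φ_{p^{n+1}}(1+T) ∣ g` in `Λ` ⟺ `HasSum (k ↦ L_k (ζ − 1)^k) 0`, i.e. `L(ζ − 1) = 0`.
[cite: MazurTateTeitelbaum1986Invent, §I.12–I.13] [cite: Washington1997, §7.2] -/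
theorem cyclotomic_comp_dvd_iff_hasSum_ratSeries_zero (n : ℕ) {g : IwasawaAlgebra p} {L : PowerSeries ℚ_[p]}
    {c : ℚ_[p]} (hc : c ≠ 0) (hg : iwasawaToPowerSeries p g = PowerSeries.C c * L) {ζ : ℂ_[p]}
    (hζ : IsPrimitiveRoot ζ (p ^ (n + 1))) :
    ((((cyclotomic (p ^ (n + 1)) ℤ).comp (X + 1)).map (Int.castRingHom ℤ_[p]) : ℤ_[p][X]) : IwasawaAlgebra p) ∣ g ↔
      HasSum (fun k ↦ algebraMap ℚ_[p] ℂ_[p] (PowerSeries.coeff k L) * (ζ - 1) ^ k) 0 := by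
  rw [cyclotomic_comp_dvd_iff_hasSum_zero n g hζ]
  have hcoeff : ∀ k, ((algebraMap ℚ_[p] ℂ_[p]).comp (algebraMap ℤ_[p] ℚ_[p])) (PowerSeries.coeff k g) * (ζ - 1) ^ k =
      algebraMap ℚ_[p] ℂ_[p] c * (algebraMap ℚ_[p] ℂ_[p] (PowerSeries.coeff k L) * (ζ - 1) ^ k) := by
    intro k
    have h1 : algebraMap ℤ_[p] ℚ_[p] (PowerSeries.coeff k g) = c * PowerSeries.coeff k L := by
      rw [← PowerSeries.coeff_map, ← iwasawaToPowerSeries, hg, PowerSeries.coeff_C_mul]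
    rw [RingHom.comp_apply, h1, map_mul, mul_assoc]
  have hc' : algebraMap ℚ_[p] ℂ_[p] c ≠ 0 := (_root_.map_ne_zero _).mpr hc
  simp_rw [hcoeff]
  refine ⟨fun h ↦ ?_, fun h ↦ by simpa using h.mul_left (algebraMap ℚ_[p] ℂ_[p] c)⟩
  have h2 := h.mul_left (algebraMap ℚ_[p] ℂ_[p] c)⁻¹
  simp_rw [← mul_assoc, inv_mul_cancel₀ hc', one_mul, mul_zero] at h2
  exact h2

end Summit.BirchSwinnertonDyer.BirchSwinnertonDyer.Theorems.LambdaTransportDoorCharEvalBridge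

end
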